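import Summits.CriticalPhenomena.PercolationContinuityZ3.Theses.PercNonProliferation
import Literature.Probability.LatticeModels.RandomClusterDomainMarkov

/-! Scratch: prove the two deterministic inclusions (G2) TopBoxInclusion and (G1) one slab case,
to certify the path-chasing used in card `fkg-gate-calculus`. -/

noncomputable section

namespace Summit.CriticalPhenomena.PercolationContinuityZ3.Cruxes.SubpolynomialBlocking.SketchProofs

open MeasureTheory Filter
open Literature.Probability.LatticeModels Literature.Probability.Percolation
open Summit.CriticalPhenomena.PercolationContinuityZ3.Theses.PercNonProliferation

def blockAnn (m M : ℕ) : Set (BondConfig (Site 3)) :=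
  {ω | ¬ ∃ x ∈ box 3 m, ∃ y ∈ innerBoundary (zdGraph 3) (box 3 M),
      ω ∈ openConnIn (↑(box 3 M) : Set (Site 3)) x y}

def rect (a b : Fin 3 → ℤ) : Set (Site 3) := {x | ∀ i, a i ≤ x i ∧ x i ≤ b i}

def blockDir (a b : Fin 3 → ℤ) (i : Fin 3) : Set (BondConfig (Site 3)) :=
  {ω | ¬ ∃ x ∈ rect a b, ∃ y ∈ rect a b, x i = a i ∧ y i = b i ∧ ω ∈ openConnIn (rect a b) x y}

theorem openConnIn_mono_local {V : Type*} {S S' : Set V} (h : S ⊆ S') (x y : V) :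
    (openConnIn S x y : Set (BondConfig V)) ⊆ openConnIn S' x y := by
  rintro ω ⟨hx, hy, hr⟩
  exact ⟨h hx, h hy, hr.map (SimpleGraph.induceHomOfLE (G := openGraph ω) h).toHom⟩

/-- (G2): annulus blocking forces thin-direction blocking of the top box `[-n,n]² × [n,2n]`. -/
theorem topBoxInclusion (n : ℕ) (ω : BondConfig (Site 3)) (hω : ω ∈ blockAnn n (2 * n)) :
    ω ∈ blockDir ![-(n : ℤ), -(n : ℤ), (n : ℤ)] ![(n : ℤ), (n : ℤ), (2 * n : ℤ)] 2 := by
  rintro ⟨x, hx, y, hy, hx2, hy2, hconn⟩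
  apply hω
  have hsub : rect ![-(n : ℤ), -(n : ℤ), (n : ℤ)] ![(n : ℤ), (n : ℤ), (2 * n : ℤ)] ⊆
      (↑(box 3 (2 * n)) : Set (Site 3)) := by
    intro z hz
    rw [Finset.mem_coe, mem_box]
    intro i
    have h0 := hz 0; have h1 := hz 1; have h2 := hz 2
    fin_cases i <;> simp at h0 h1 h2 ⊢ <;> push_cast at * <;> omega
  refine ⟨x, ?_, y, ?_, openConnIn_mono_local hsub x y hconn⟩
  · rw [mem_box]
    intro i
    have h0 := hx 0; have h1 := hx 1; have h2 := hx 2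
    simp at hx2
    fin_cases i <;> simp at h0 h1 h2 ⊢ <;> push_cast at * <;> omega
  · have hyb : y ∈ box 3 (2 * n) := by
      have := hsub hy
      rwa [Finset.mem_coe] at this
    refine mem_innerBoundary_box_of_apply_eq hyb 2 ?_
    simp at hy2
    push_cast
    exact hy2

end Summit.CriticalPhenomena.PercolationContinuityZ3.Cruxes.SubpolynomialBlocking.SketchProofs
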